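import Summits.HubbardSuperconductivity.HubbardSuperconductivity.Theorems.AnisotropyChordTransferFibre3S2Tail
import Summits.HubbardSuperconductivity.HubbardSuperconductivity.Theorems.AnisotropyChordTransferFibre3S2Pointwise
import Summits.HubbardSuperconductivity.HubbardSuperconductivity.Theorems.AnisotropyChordTransferFibre3ShellIngredients

/-!
# Route `AnisotropyChord` / H0 rotor rung: PartN35 LEMMA L2-B1 — the L-UNIFORM BRACKET `S2UniformBracket` PROVED

`s2UniformBracket_holds : S2UniformBracket L` (`…Fibre3Level2Toolkit`, PORT PartN35, memo ROTOR-THEORY-21 §311(b); every `L`):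
for `L ≥ L₀ ≥ 8`, `4 ∣ L₀`, `K = L₀/4`, `θ₀ = 2π/L₀`, `0 ≤ ν < 4/π²`, `λ = ν(2π/L)²`,
`xi2lo ν K ≤ 16π⁴ S₂/L⁴ ≤ xi2hi ν θ₀ K`.

With `θ = 2π/L`, `16π⁴ g(k)²/L⁴ = θ⁴/(2ε(k) − νθ²)²` and `2ε(k) = 2(1−cos θm) + 2(1−cos θn)` at the centred representative
`(m,n) = (valMinAbs k₁, valMinAbs k₂)` (`two_epsT_eq_rep`).  LOWER: the window `zWindow K` injects into the torus
(`|m| ≤ K ≤ L/4`), and `2(1−cos x) ≤ x²`, `2(1−cos x) ≥ (4/π²)x²` (`|x| ≤ π`) give `1/(|p|²−ν)² ≤ θ⁴ g²`.  UPPER: every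
`k ≠ 0` is either a window point — then `x² − x⁴/12 ≤ 2(1−cos x)` (`sq_sub_quartic_le`, from `sin y ≥ y − y³/6`) and
`θ ≤ θ₀` give the `xi2hi` window summand — or a tail point `K < |p|∞ ≤ L/2`, where Jordan (`jordanEpsLower_holds`, p2)
gives `θ⁴g² ≤ (π⁴/16)/(|p|²−νπ²/4)²`, summed by `tail_sum_le` (`…Fibre3S2Tail`) to the constant `(π⁵/16)/((K−1)²−νπ²/4)`.
Prover seat `hubbard-h0-rotor-p3` g2; helper for stmt-HubbardSuperconductivity-19089 (`--supports`, helper class).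
Nothing here proves superconductivity in the Hubbard model; helper lemmas of ONE conditional reduction (rung 19089);
the rotor TARGET as originally worded stays FALSE (g15 verdict).  Mathlib + the tree only; no sorry.
-/

set_option linter.dupNamespace false
set_option autoImplicit false

noncomputable section

open scoped BigOperators

namespace Summit.HubbardSuperconductivity.HubbardSuperconductivity.Theorems.AnisotropyChord.Transfer.Fibre3

variable (L : ℕ) [NeZero L]

/-! ## The theorem -/

/-- **LEMMA L2-B1: `S2UniformBracket` holds** for every `L` (PartN35, memo 21 §311(b)). -/
theorem s2UniformBracket_holds : S2UniformBracket L := by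
  intro L0 hL0 h4 hL0L ν hν0 hν1
  obtain ⟨K, hK⟩ := h4
  have hKdef : L0 / 4 = K := by rw [hK]; exact Nat.mul_div_cancel_left K (by norm_num)
  rw [hKdef]
  unfold xi2lo xi2hi
  have hK2 : 2 ≤ K := by omega
  have hLpos : (0 : ℝ) < L := by exact_mod_cast Nat.pos_of_ne_zero (NeZero.ne L)
  have hL0pos : (0 : ℝ) < L0 := by exact_mod_cast (show 0 < L0 by omega)
  have hL0R : (L0 : ℝ) = 4 * K := by exact_mod_cast hK
  have hKR : (2 : ℝ) ≤ K := by exact_mod_cast hK2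
  have hL0L' : (L0 : ℝ) ≤ L := by exact_mod_cast hL0L
  have hpipos := Real.pi_pos
  -- the scales
  set θ : ℝ := 2 * Real.pi / L with hθ
  set θ0 : ℝ := 2 * Real.pi / L0 with hθ0
  have hθpos : 0 < θ := by rw [hθ]; positivity
  have hθle : θ ≤ θ0 := by
    rw [hθ, hθ0]
    exact div_le_div_of_nonneg_left (by positivity) hL0pos hL0L'
  have hθ0K : θ0 * K = Real.pi / 2 := by rw [hθ0, hL0R]; field_simp; ring
  have hθK : θ * K ≤ Real.pi / 2 := by nlinarith
  have ha1 : ν * Real.pi ^ 2 / 4 < 1 := by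
    rw [div_lt_one (by norm_num)]
    have := (lt_div_iff₀ (by positivity)).mp hν1
    linarith
  have ha0 : 0 ≤ ν * Real.pi ^ 2 / 4 := by positivity
  -- the middle quantity as a sum of `θ⁴ g²`
  set T : Tor L → ℝ := fun k => θ ^ 4 * gres L (ν * θ ^ 2) k ^ 2 with hT
  have hT0 : ∀ k, 0 ≤ T k := fun k => by positivity
  have hmid : 16 * Real.pi ^ 4 * S2sum L (ν * θ ^ 2) / (L : ℝ) ^ 4 = ∑ k : Tor L, T k := by
    unfold S2sum
    rw [Finset.mul_sum, Finset.sum_div]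
    refine Finset.sum_congr rfl fun k _ => ?_
    rw [hT, hθ]
    field_simp
    ring
  rw [hmid]
  -- pointwise form of `T` off the origin
  have hTk : ∀ k : Tor L, k ≠ 0 → T k = θ ^ 4 / (2 * epsT L k - ν * θ ^ 2) ^ 2 := by
    intro k hk
    rw [hT]
    dsimp only
    unfold gres
    rw [if_neg hk, one_div, inv_pow, div_eq_mul_inv]
  -- membership in the windows
  have memW : ∀ (M : ℕ) (p : ℤ × ℤ), p ∈ zWindow M ↔
      p ≠ (0, 0) ∧ (-(M : ℤ) ≤ p.1 ∧ p.1 ≤ M) ∧ (-(M : ℤ) ≤ p.2 ∧ p.2 ≤ M) := by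
    intro M p
    unfold zWindow
    simp only [Finset.mem_erase, Finset.mem_product, Finset.mem_Icc, ne_eq]
  constructor
  · ----------------------------------------------------------------
    -- LOWER BOUND: the window injects into the torus
    ----------------------------------------------------------------
    set ι : ℤ × ℤ → Tor L := fun p => (((p.1 : ℤ) : ZMod L), ((p.2 : ℤ) : ZMod L)) with hι
    have hinj : Set.InjOn ι (zWindow K : Set (ℤ × ℤ)) := by
      intro p hp q hq hpq
      rw [Finset.mem_coe, memW] at hp hq
      have e1 : ((p.1 : ℤ) : ZMod L) = ((q.1 : ℤ) : ZMod L) := congrArg Prod.fst hpq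
      have e2 : ((p.2 : ℤ) : ZMod L) = ((q.2 : ℤ) : ZMod L) := congrArg Prod.snd hpq
      rw [ZMod.intCast_eq_intCast_iff_dvd_sub] at e1 e2
      have d1 := Int.eq_zero_of_abs_lt_dvd e1 (by rw [abs_lt]; omega)
      have d2 := Int.eq_zero_of_abs_lt_dvd e2 (by rw [abs_lt]; omega)
      exact Prod.ext (by omega) (by omega)
    have hterm : ∀ p ∈ zWindow K, 1 / ((((p.1 : ℝ)) ^ 2 + ((p.2 : ℝ)) ^ 2) - ν) ^ 2 ≤ T (ι p) := by
      intro p hp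
      rw [memW] at hp
      obtain ⟨hp0, ⟨h1a, h1b⟩, ⟨h2a, h2b⟩⟩ := hp
      have hne : ι p ≠ 0 := by
        intro h0
        have z1 : ((p.1 : ℤ) : ZMod L) = 0 := congrArg Prod.fst h0
        have z2 : ((p.2 : ℤ) : ZMod L) = 0 := congrArg Prod.snd h0
        rw [ZMod.intCast_zmod_eq_zero_iff_dvd] at z1 z2
        have d1 := Int.eq_zero_of_abs_lt_dvd z1 (by rw [abs_lt]; omega)
        have d2 := Int.eq_zero_of_abs_lt_dvd z2 (by rw [abs_lt]; omega)
        exact hp0 (Prod.ext d1 d2)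
      rw [hTk _ hne]
      have hE : 2 * epsT L (ι p) = 2 * (1 - Real.cos (θ * p.1)) + 2 * (1 - Real.cos (θ * p.2)) := by
        have c1 := cos_two_pi_val_intCast L p.1
        have c2 := cos_two_pi_val_intCast L p.2
        unfold epsT
        rw [show (ι p).1 = ((p.1 : ℤ) : ZMod L) from rfl, show (ι p).2 = ((p.2 : ℤ) : ZMod L) from rfl,
          c1, c2, hθ]
        ring_nf
      rw [hE]
      exact lower_termwise θ ν p.1 p.2 hθpos hν1 (one_le_sq_add_sq p.1 p.2 hp0)
        (abs_angle_le_pi θ K hθpos hθK p.1 h1a h1b) (abs_angle_le_pi θ K hθpos hθK p.2 h2a h2b)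
    calc ∑ p ∈ zWindow K, 1 / ((((p.1 : ℝ)) ^ 2 + ((p.2 : ℝ)) ^ 2) - ν) ^ 2
        ≤ ∑ p ∈ zWindow K, T (ι p) := Finset.sum_le_sum hterm
      _ = ∑ k ∈ (zWindow K).image ι, T k := (Finset.sum_image hinj).symm
      _ ≤ ∑ k : Tor L, T k :=
          Finset.sum_le_sum_of_subset_of_nonneg (Finset.subset_univ _) (fun k _ _ => hT0 k)
  · ----------------------------------------------------------------
    -- UPPER BOUND: window + tail
    ----------------------------------------------------------------
    set N : ℕ := L / 2 with hN
    have hKN : K ≤ N := by rw [hN]; omega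
    set rep : Tor L → ℤ × ℤ := fun k => ((k.1.valMinAbs : ℤ), (k.2.valMinAbs : ℤ)) with hrep
    have hrep_inj : Function.Injective rep := by
      intro k k' h
      have e1 : k.1.valMinAbs = k'.1.valMinAbs := congrArg Prod.fst h
      have e2 : k.2.valMinAbs = k'.2.valMinAbs := congrArg Prod.snd h
      exact Prod.ext (ZMod.valMinAbs_inj.mp e1) (ZMod.valMinAbs_inj.mp e2)
    -- the two majorants on `ℤ²`
    set w : ℤ × ℤ → ℝ := fun p => 1 / (((p.1 : ℝ) ^ 2 * (1 - θ0 ^ 2 * (p.1 : ℝ) ^ 2 / 12)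
        + (p.2 : ℝ) ^ 2 * (1 - θ0 ^ 2 * (p.2 : ℝ) ^ 2 / 12)) - ν) ^ 2 with hw
    set f : ℤ × ℤ → ℝ := fun p => 1 / ((((p.1 : ℝ)) ^ 2 + ((p.2 : ℝ)) ^ 2) - ν * Real.pi ^ 2 / 4) ^ 2 with hf
    set Aw : ℤ × ℤ → ℝ := fun p => if p ∈ zWindow K then w p else 0 with hAw
    set Bt : ℤ × ℤ → ℝ := fun p => if p ∈ zWindow N \ zWindow K then Real.pi ^ 4 / 16 * f p else 0 with hBt
    have hw0 : ∀ p, 0 ≤ w p := fun p => by rw [hw]; positivity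
    have hf0 : ∀ p, 0 ≤ f p := fun p => by rw [hf]; positivity
    have hAw0 : ∀ p, 0 ≤ Aw p := fun p => by
      rw [hAw]; dsimp only; split_ifs
      · exact hw0 p
      · exact le_rfl
    have hBt0 : ∀ p, 0 ≤ Bt p := fun p => by
      rw [hBt]; dsimp only; split_ifs
      · exact mul_nonneg (by positivity) (hf0 p)
      · exact le_rfl
    -- pointwise domination `T k ≤ Aw (rep k) + Bt (rep k)`
    have hdom : ∀ k : Tor L, T k ≤ Aw (rep k) + Bt (rep k) := by
      intro k
      by_cases hk : k = 0
      · have : T k = 0 := by rw [hT]; simp [hk, gres]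
        rw [this]
        exact add_nonneg (hAw0 _) (hBt0 _)
      have hrk : rep k = (k.1.valMinAbs, k.2.valMinAbs) := rfl
      have hmN : k.1.valMinAbs.natAbs ≤ L / 2 := ZMod.natAbs_valMinAbs_le k.1
      have hnN : k.2.valMinAbs.natAbs ≤ L / 2 := ZMod.natAbs_valMinAbs_le k.2
      have hp0 : (k.1.valMinAbs, k.2.valMinAbs) ≠ (0, 0) := by
        intro h
        apply hk
        exact Prod.ext ((ZMod.valMinAbs_eq_zero _).mp (congrArg Prod.fst h))
          ((ZMod.valMinAbs_eq_zero _).mp (congrArg Prod.snd h))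
      have hmemN : (k.1.valMinAbs, k.2.valMinAbs) ∈ zWindow N := by
        rw [memW]
        refine ⟨hp0, ⟨?_, ?_⟩, ⟨?_, ?_⟩⟩ <;> omega
      have hE : 2 * epsT L k = 2 * (1 - Real.cos (θ * k.1.valMinAbs)) + 2 * (1 - Real.cos (θ * k.2.valMinAbs)) := by
        rw [two_epsT_eq_rep, hθ]
        ring_nf
      have hjordan : 4 / Real.pi ^ 2 * θ ^ 2 * (((k.1.valMinAbs : ℤ) : ℝ) ^ 2 + ((k.2.valMinAbs : ℤ) : ℝ) ^ 2)
          ≤ 2 * epsT L k := by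
        have hj := RateLemma.jordanEpsLower_holds L k
        rw [hθ]
        calc 4 / Real.pi ^ 2 * (2 * Real.pi / L) ^ 2 * (((k.1.valMinAbs : ℤ) : ℝ) ^ 2 + ((k.2.valMinAbs : ℤ) : ℝ) ^ 2)
            = 2 * (2 / Real.pi ^ 2 * (2 * Real.pi / L) ^ 2
                * (((k.1.valMinAbs : ℤ) : ℝ) ^ 2 + ((k.2.valMinAbs : ℤ) : ℝ) ^ 2)) := by ring
          _ ≤ 2 * epsT L k := by linarith
      have hs := one_le_sq_add_sq _ _ hp0
      rw [hTk k hk, hrk]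
      by_cases hwin : (k.1.valMinAbs, k.2.valMinAbs) ∈ zWindow K
      · -- window point: Taylor bracket with `θ ≤ θ₀`
        have hAval : Aw (k.1.valMinAbs, k.2.valMinAbs) = w (k.1.valMinAbs, k.2.valMinAbs) := by
          rw [hAw]; dsimp only; rw [if_pos hwin]
        rw [hAval]
        have hwin' := hwin
        rw [memW] at hwin'
        obtain ⟨_, ⟨h1a, h1b⟩, ⟨h2a, h2b⟩⟩ := hwin'
        have hmK : ((k.1.valMinAbs : ℤ) : ℝ) ^ 2 ≤ (K : ℝ) ^ 2 := by
          have : |((k.1.valMinAbs : ℤ) : ℝ)| ≤ K := by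
            rw [abs_le]; constructor <;> exact_mod_cast (by omega : _)
          nlinarith [abs_nonneg ((k.1.valMinAbs : ℤ) : ℝ), sq_abs ((k.1.valMinAbs : ℤ) : ℝ)]
        have hnK : ((k.2.valMinAbs : ℤ) : ℝ) ^ 2 ≤ (K : ℝ) ^ 2 := by
          have : |((k.2.valMinAbs : ℤ) : ℝ)| ≤ K := by
            rw [abs_le]; constructor <;> exact_mod_cast (by omega : _)
          nlinarith [abs_nonneg ((k.2.valMinAbs : ℤ) : ℝ), sq_abs ((k.2.valMinAbs : ℤ) : ℝ)]
        have key := window_termwise θ θ0 ν _ _ (K : ℝ) hθpos hθle hθ0K hν1 hs hmK hnK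
          (abs_angle_le_pi θ K hθpos hθK _ h1a h1b) (abs_angle_le_pi θ K hθpos hθK _ h2a h2b)
        rw [hE]
        have e : w (k.1.valMinAbs, k.2.valMinAbs) = 1 / ((((k.1.valMinAbs : ℤ) : ℝ) ^ 2
            * (1 - θ0 ^ 2 * ((k.1.valMinAbs : ℤ) : ℝ) ^ 2 / 12) + ((k.2.valMinAbs : ℤ) : ℝ) ^ 2
            * (1 - θ0 ^ 2 * ((k.2.valMinAbs : ℤ) : ℝ) ^ 2 / 12)) - ν) ^ 2 := rfl
        rw [e]
        linarith [hBt0 (k.1.valMinAbs, k.2.valMinAbs)]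
      · -- tail point: Jordan
        have hmemT : (k.1.valMinAbs, k.2.valMinAbs) ∈ zWindow N \ zWindow K :=
          Finset.mem_sdiff.mpr ⟨hmemN, hwin⟩
        have hAval : Aw (k.1.valMinAbs, k.2.valMinAbs) = 0 := by rw [hAw]; dsimp only; rw [if_neg hwin]
        have hBval : Bt (k.1.valMinAbs, k.2.valMinAbs) = Real.pi ^ 4 / 16 * f (k.1.valMinAbs, k.2.valMinAbs) := by
          rw [hBt]; dsimp only; rw [if_pos hmemT]
        rw [hAval, hBval, zero_add]
        exact tail_termwise θ ν _ _ hθpos (by linarith) hjordan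
    -- summing the domination through the injection `rep`
    have hsumA : ∑ k : Tor L, Aw (rep k) ≤ ∑ p ∈ zWindow K, w p := by
      rw [← Finset.sum_image (fun x _ y _ h => hrep_inj h)]
      rw [hAw, ← Finset.sum_filter]
      apply Finset.sum_le_sum_of_subset_of_nonneg
      · intro p hp
        exact (Finset.mem_filter.mp hp).2
      · intro p _ _
        exact hw0 p
    have hsumB : ∑ k : Tor L, Bt (rep k) ≤ Real.pi ^ 4 / 16 * ∑ p ∈ zWindow N \ zWindow K, f p := by
      rw [← Finset.sum_image (fun x _ y _ h => hrep_inj h)]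
      rw [hBt, ← Finset.sum_filter, Finset.mul_sum]
      apply Finset.sum_le_sum_of_subset_of_nonneg
      · intro p hp
        exact (Finset.mem_filter.mp hp).2
      · intro p _ _
        exact mul_nonneg (by positivity) (hf0 p)
    have htail := tail_sum_le K N hK2 hKN (ν * Real.pi ^ 2 / 4) ha0 ha1
    have hKpos : 0 < ((K : ℝ) - 1) ^ 2 - ν * Real.pi ^ 2 / 4 := by nlinarith
    calc ∑ k : Tor L, T k ≤ ∑ k : Tor L, (Aw (rep k) + Bt (rep k)) := Finset.sum_le_sum fun k _ => hdom k
      _ = ∑ k : Tor L, Aw (rep k) + ∑ k : Tor L, Bt (rep k) := Finset.sum_add_distrib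
      _ ≤ ∑ p ∈ zWindow K, w p + Real.pi ^ 4 / 16 * ∑ p ∈ zWindow N \ zWindow K, f p :=
          add_le_add hsumA hsumB
      _ ≤ ∑ p ∈ zWindow K, w p + Real.pi ^ 4 / 16 * (Real.pi / (((K : ℝ) - 1) ^ 2 - ν * Real.pi ^ 2 / 4)) := by
          gcongr
      _ = ∑ p ∈ zWindow K, w p + Real.pi ^ 5 / 16 / (((K : ℝ) - 1) ^ 2 - ν * Real.pi ^ 2 / 4) := by
          congr 1
          rw [mul_div_assoc', div_div, show Real.pi ^ 4 / 16 * Real.pi = Real.pi ^ 5 / 16 by ring, div_div]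

end Summit.HubbardSuperconductivity.HubbardSuperconductivity.Theorems.AnisotropyChord.Transfer.Fibre3

end
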